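import Summits.Ventures.PercRepro.MergeTypes
import Summits.Ventures.PercRepro.TypeIdentity
import Summits.Ventures.PercRepro.Relabel

/-!
# PercRepro — the type identity is a theorem (typer-2, gen 3)

The bridge between typer-1's graph half (`MergeTypes.lean`: `typeOfConfig`, `mem_typeEvent_iff`,
`mergeVec_eq_zero`, `mergeVec_mem_variants`) and typer-2's algebra half (`TypeIdentity.lean`:
`MergeClassification`, `TypeIdentity_of_classification`):

* `rows_of_mergeVec_eq` — a merge vector `e_t − e_s` fixes the rows before (`s`) and after (`t`);
* **`mergeClassification`** — every marked multigraph and edge satisfies `MergeClassification`;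
* **`TypeIdentity_holds : TypeIdentity`**, hence **`C011_of_Concavity6Mark'`**,
  **`C005_of_Lemma6GenSure_5bSure'`** without the `TypeIdentity` hypothesis.
-/

namespace PercRepro

open Finset Merge4

namespace MultiGraph

variable {V E : Type*} (G : MultiGraph V E) [DecidableEq E] (g : E) (a b c d : V)

/-- typer-1's `mergeVec` is `mergeVecM` at the marks `![a, b, c, d]`. -/
theorem mergeVec_eq_mergeVecM (ω : Config E) :
    G.mergeVec g a b c d ω = G.mergeVecM g ![a, b, c, d] ω := rfl

/-- A merge vector of the form `e_t − e_s` (`t ≠ s`) fixes the rows before and after. -/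
theorem rows_of_mergeVec_eq {ω : Config E} {t s : Fin 15} (hts : t ≠ s)
    (h : G.mergeVec g a b c d ω = fun r => (((e t - e s) r : ℤ) : ℝ)) :
    G.rowClosed g ![a, b, c, d] ω = s ∧ G.rowOpened g ![a, b, c, d] ω = t := by
  have hs := congrFun h s
  have ht := congrFun h t
  simp only [mergeVec, e, Pi.sub_apply, hts, if_true, if_false, Int.cast_sub, Int.cast_one,
    Int.cast_zero, Ne.symm hts] at hs ht
  change (if G.rowOpened g ![a, b, c, d] ω = s then (1 : ℝ) else 0) -
    (if G.rowClosed g ![a, b, c, d] ω = s then 1 else 0) = 0 - 1 at hs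
  change (if G.rowOpened g ![a, b, c, d] ω = t then (1 : ℝ) else 0) -
    (if G.rowClosed g ![a, b, c, d] ω = t then 1 else 0) = 1 - 0 at ht
  constructor
  · by_contra hc
    rw [if_neg hc] at hs
    split_ifs at hs <;> norm_num at hs
  · by_contra hc
    rw [if_neg hc] at ht
    split_ifs at ht <;> norm_num at ht

/-- A zero merge vector means the row does not move. -/
theorem rows_of_mergeVec_zero {ω : Config E} (h : G.mergeVec g a b c d ω = fun _ => 0) :
    G.rowOpened g ![a, b, c, d] ω = G.rowClosed g ![a, b, c, d] ω := by
  have ht := congrFun h (G.rowOpened g ![a, b, c, d] ω)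
  change (if G.rowOpened g ![a, b, c, d] ω = G.rowOpened g ![a, b, c, d] ω then (1 : ℝ) else 0) -
    (if G.rowClosed g ![a, b, c, d] ω = G.rowOpened g ![a, b, c, d] ω then 1 else 0) = 0 at ht
  rw [if_pos rfl] at ht
  by_contra hc
  rw [if_neg (Ne.symm hc)] at ht
  norm_num at ht

/-- Membership in a type event as `typeOfConfig`. -/
theorem typeOfConfig_of_mem {ω : Config E} {T : MType} (h : ω ∈ G.typeEvent g a b c d T) :
    G.typeOfConfig g a b c d ω = some T :=
  (G.mem_typeEvent_iff g a b c d ω T).mp h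

/-- Two different types are disjoint. -/
theorem disjoint_typeEvent {T T' : MType} (h : T ≠ T') :
    Disjoint (G.typeEvent g a b c d T) (G.typeEvent g a b c d T') := by
  rw [Set.disjoint_left]
  intro ω h1 h2
  have e1 := G.typeOfConfig_of_mem g a b c d h1
  have e2 := G.typeOfConfig_of_mem g a b c d h2
  exact h (Option.some_injective _ (e1.symm.trans e2))

/-- **Every marked multigraph satisfies the merge-type classification.** -/
theorem mergeClassification : G.MergeClassification g a b c d where
  rowsA := by
    intro i ω hω
    have hT := G.typeOfConfig_of_mem g a b c d (T := .A i) hω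
    obtain ⟨v, hv, hvec⟩ := G.mergeVec_mem_variants g a b c d ω (.A i) hT
    fin_cases i <;> simp only [variants, List.mem_cons, List.not_mem_nil,
      or_false] at hv <;> rcases hv with rfl | rfl <;>
      obtain ⟨h1, h2⟩ := G.rows_of_mergeVec_eq g a b c d (by decide) hvec <;>
      simp [h1, h2, r1Row, r2Row]
  rowsB := by
    intro i ω hω
    have hT := G.typeOfConfig_of_mem g a b c d (T := .B i) hω
    obtain ⟨v, hv, hvec⟩ := G.mergeVec_mem_variants g a b c d ω (.B i) hT
    fin_cases i <;> simp only [variants, List.mem_cons, List.not_mem_nil,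
      or_false] at hv <;> rcases hv with rfl | rfl <;>
      obtain ⟨h1, h2⟩ := G.rows_of_mergeVec_eq g a b c d (by decide) hvec <;>
      simp [h1, h2, r1Row, r2Row, xRow]
  rowsC := by
    intro i ω hω
    have hT := G.typeOfConfig_of_mem g a b c d (T := .C i) hω
    obtain ⟨v, hv, hvec⟩ := G.mergeVec_mem_variants g a b c d ω (.C i) hT
    fin_cases i <;> simp only [variants, List.mem_cons, List.not_mem_nil,
      or_false] at hv <;> rcases hv with rfl | rfl | rfl | rfl <;>
      obtain ⟨h1, h2⟩ := G.rows_of_mergeVec_eq g a b c d (by decide) hvec <;>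
      simp [h1, h2, r1Row, r2Row, threeOneRows]
  rowsD := by
    intro i ω hω
    have hT := G.typeOfConfig_of_mem g a b c d (T := .D i) hω
    obtain ⟨v, hv, hvec⟩ := G.mergeVec_mem_variants g a b c d ω (.D i) hT
    fin_cases i <;> simp only [variants, List.mem_cons, List.not_mem_nil,
      or_false] at hv <;> subst hv <;>
      obtain ⟨h1, h2⟩ := G.rows_of_mergeVec_eq g a b c d (by decide) hvec <;>
      simp [h1, h2, xRow]
  rowsE := by
    intro ω hω
    have hT := G.typeOfConfig_of_mem g a b c d (T := .E) hω
    obtain ⟨v, hv, hvec⟩ := G.mergeVec_mem_variants g a b c d ω .E hT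
    simp only [variants, List.mem_cons, List.not_mem_nil, or_false] at hv
    rcases hv with rfl | rfl | rfl | rfl <;>
      obtain ⟨h1, h2⟩ := G.rows_of_mergeVec_eq g a b c d (by decide) hvec <;>
      simp [h1, h2, threeOneRows]
  noMove := by
    intro ω hA hB hC hD hE
    have hnone : G.typeOfConfig g a b c d ω = none := by
      rcases h : G.typeOfConfig g a b c d ω with _ | T
      · rfl
      · exfalso
        have hmem : ω ∈ G.typeEvent g a b c d T := (G.mem_typeEvent_iff g a b c d ω T).mpr h
        cases T with
        | A i => exact hA i hmem
        | B i => exact hB i hmem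
        | C i => exact hC i hmem
        | D i => exact hD i hmem
        | E => exact hE hmem
    exact G.rows_of_mergeVec_zero g a b c d (G.mergeVec_eq_zero g a b c d ω hnone)
  disjAA := fun i j hij => G.disjoint_typeEvent g a b c d (T := .A i) (T' := .A j) (by simp [hij])
  disjBB := fun i j hij => G.disjoint_typeEvent g a b c d (T := .B i) (T' := .B j) (by simp [hij])
  disjCC := fun i j hij => G.disjoint_typeEvent g a b c d (T := .C i) (T' := .C j) (by simp [hij])
  disjDD := fun i j hij => G.disjoint_typeEvent g a b c d (T := .D i) (T' := .D j) (by simp [hij])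
  disjAB := fun i j => G.disjoint_typeEvent g a b c d (T := .A i) (T' := .B j) (by simp)
  disjAC := fun i j => G.disjoint_typeEvent g a b c d (T := .A i) (T' := .C j) (by simp)
  disjAD := fun i j => G.disjoint_typeEvent g a b c d (T := .A i) (T' := .D j) (by simp)
  disjAE := fun i => G.disjoint_typeEvent g a b c d (T := .A i) (T' := .E) (by simp)
  disjBC := fun i j => G.disjoint_typeEvent g a b c d (T := .B i) (T' := .C j) (by simp)
  disjBD := fun i j => G.disjoint_typeEvent g a b c d (T := .B i) (T' := .D j) (by simp)
  disjBE := fun i => G.disjoint_typeEvent g a b c d (T := .B i) (T' := .E) (by simp)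
  disjCD := fun i j => G.disjoint_typeEvent g a b c d (T := .C i) (T' := .D j) (by simp)
  disjCE := fun i => G.disjoint_typeEvent g a b c d (T := .C i) (T' := .E) (by simp)
  disjDE := fun i => G.disjoint_typeEvent g a b c d (T := .D i) (T' := .E) (by simp)

end MultiGraph

/-- **The type identity is a theorem**: `Q⁺(Δ_g, Δ_g) = sixMarkLHS − sixMarkRHS` for every finite
multigraph, every `p`, every four marks and every edge. -/
theorem TypeIdentity_holds : TypeIdentity :=
  TypeIdentity_of_classification fun G g a b c d => G.mergeClassification g a b c d

/-- The 6-mark form of the concavity lemma for every edge gives C-005⁺ (no hypothesis left). -/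
theorem C011_of_Concavity6Mark' (h6 : Concavity6Mark) : C011 :=
  C011_of_Concavity6Mark TypeIdentity_holds h6

/-- **The dossier's chain, closed**: `Lemma6GenSure → Concavity5bSure → C011`. -/
theorem C011_of_Lemma6GenSure_5bSure' (h6 : Lemma6GenSure) (hb : Concavity5bSure) : C011 :=
  C011_of_Lemma6GenSure_5bSure TypeIdentity_holds h6 hb

/-- **The dossier's chain, closed**: `Lemma6GenSure → Concavity5bSure → C005`. -/
theorem C005_of_Lemma6GenSure_5bSure' (h6 : Lemma6GenSure) (hb : Concavity5bSure) : C005 :=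
  C005_of_Lemma6GenSure_5bSure TypeIdentity_holds h6 hb

/-- Lemma 5 on every minor gives C-005⁺ (no hypothesis left). -/
theorem C011_of_Concavity5MarkSure' (h : Concavity5MarkSure) : C011 :=
  C011_of_Concavity5MarkSure TypeIdentity_holds h

end PercRepro
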